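import Mathlib
import HarnessLib
import Literature.Analysis.FluidPDE.TypeIAncientMild
import Literature.Analysis.FluidPDE.KNSSRemark61
import Literature.Analysis.FluidPDE.CurlFreeLiouville
import Literature.Analysis.FluidPDE.NSLocalLerayBackwardUniqueness
import Literature.Analysis.FluidPDE.BarkerPrange2020VorticityAlignmentTypeIHolds
import Literature.Analysis.UnboundedOperators.HeatKernelBoundedData
import Summits.NavierStokesRegularity.NavierStokesRegularity.Theorems.PoloidalWindowDoorPoloidalWindowRigidityWindow

/-!
# Route `PoloidalWindowDoor`, crux `PoloidalWindowRigidity` (K2, stmt-NavierStokesRegularity-19708) — STUB HP4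
# `stub_slabNullRigidity` of line `hot_loops` v2 (ns-idea-8 g6): IRROTATIONAL PATCHES ON ALL NEARBY PLANES AND TIMES
# ARE IMPOSSIBLE (slab rigidity)

Cell ns-regularity-ideate, seat ns-poloidal-K2-p2 g11 (stub-worker on K2; `--supports` the crux item).

* `curl_eq_zero_on_plane_of_disc` — a real-analytic field on `ℝ³` whose curl vanishes on a planar disc of the plane
  `{y₂ = z₀}` has vanishing curl on that whole plane (identity theorem on `ℝ²`, through the affine chart of the plane);
* `stub_slabNullRigidity` — VERBATIM: a profile of the route's Type-I class (rate, continuity, Oseen-mild, divergence-free;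
  poloidality is not needed) with `N = v₂(−1,0) ≠ 0` and `√(−t)|v₂| ≤ |N|` cannot carry, for all times `|s + 1| < δ`
  and all heights `|z₀| < δ`, an irrotational planar disc: planes ⇒ the slab `{|y₂| < δ}` ⇒ `curl v(s) ≡ 0` on `ℝ³`
  (tree `curl_eq_zero_of_eqOn_open`, analyticity `IsTypeIAncientMild.analyticOnNhd_slice_univ`) ⇒ `v(s,·)` constant
  (tree `eq_of_curl_eq_zero_of_isDivFree_of_bounded`) ⇒ constant in time near `−1` by the mild identity
  (tree `oseenDuhamel_eq_zero_of_const`, `heatExtension_const`) ⇒ `√(−s)|N| ≤ |N|` at some `s < −1`: absurd.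

WHAT THIS IS NOT: not a claim about Navier–Stokes regularity — a rigidity lemma for HYPOTHETICAL class profiles, all
ingredients being tree theorems (bears_on LADDER-NS N0, rung N0-LocalTubeDoorPoloidal).
-/

noncomputable section

-- the summit and its single sub-problem share the name (CONVENTIONS §1), as in every Theorems file
set_option linter.dupNamespace false

namespace Summit.NavierStokesRegularity.NavierStokesRegularity.Theorems.PoloidalWindowDoorPoloidalWindowRigidityHotLoopsSlabNullRigidity

open MeasureTheory Set Function Filter Topology Metric
open scoped RealInnerProductSpace InnerProductSpace
open Literature.Analysis Literature.Analysis.FluidPDE Literature.Analysis.UnboundedOperators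
open Summit.NavierStokesRegularity.NavierStokesRegularity.Theorems.PoloidalWindowDoorPoloidalWindowRigidityWindow
open Summit.NavierStokesRegularity.NavierStokesRegularity.Theorems.LocalSineTubeDoorProfileAlignedWindowRigidityAncient

/-- **Planar identity theorem for the curl.**  If `V : ℝ³ → ℝ³` is real-analytic and `curl V` vanishes on the planar
disc `{y₂ = z₀, dist y y₀ < r}` (`y₀₂ = z₀`, `r > 0`), then `curl V` vanishes on the whole plane `{y₂ = z₀}`. -/
theorem curl_eq_zero_on_plane_of_disc {V : EuclideanSpace ℝ (Fin 3) → EuclideanSpace ℝ (Fin 3)}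
    (hV : AnalyticOnNhd ℝ V univ) {y₀ : EuclideanSpace ℝ (Fin 3)} {z₀ r : ℝ} (hy₀ : y₀ 2 = z₀) (hr : 0 < r)
    (h : ∀ y : EuclideanSpace ℝ (Fin 3), y 2 = z₀ → dist y y₀ < r → curl V y = 0)
    (y : EuclideanSpace ℝ (Fin 3)) (hy : y 2 = z₀) : curl V y = 0 := by
  -- the affine chart of the plane
  set ι : ℝ × ℝ → EuclideanSpace ℝ (Fin 3) := fun p =>
    p.1 • EuclideanSpace.single 0 1 + p.2 • EuclideanSpace.single 1 1 + z₀ • EuclideanSpace.single 2 1 with hι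
  have hιc : Continuous ι := by rw [hι]; fun_prop
  have hιan : AnalyticOnNhd ℝ ι univ := fun p _ =>
    ((analyticAt_fst.smul analyticAt_const).add (analyticAt_snd.smul analyticAt_const)).add analyticAt_const
  have hι2 : ∀ p, ι p 2 = z₀ := fun p => by simp [hι]
  have hιsurj : ∀ w : EuclideanSpace ℝ (Fin 3), w 2 = z₀ → ι (w 0, w 1) = w := fun w hw => by
    ext i; fin_cases i <;> simp [hι, hw]
  -- `curl V ∘ ι` is analytic on `ℝ²` and vanishes near `(y₀ 0, y₀ 1)`
  have hg : AnalyticOnNhd ℝ (curl V ∘ ι) univ := (analyticOnNhd_curl hV).comp hιan (mapsTo_univ _ _)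
  have hev : (curl V ∘ ι) =ᶠ[𝓝 (y₀ 0, y₀ 1)] 0 := by
    have hopen : IsOpen {p : ℝ × ℝ | dist (ι p) y₀ < r} := isOpen_lt (hιc.dist continuous_const) continuous_const
    have hmem : (y₀ 0, y₀ 1) ∈ {p : ℝ × ℝ | dist (ι p) y₀ < r} := by
      show dist (ι (y₀ 0, y₀ 1)) y₀ < r
      rw [hιsurj y₀ hy₀, dist_self]; exact hr
    filter_upwards [hopen.mem_nhds hmem] with p hp
    exact h (ι p) (hι2 p) hp
  have hzero := hg.eqOn_zero_of_preconnected_of_eventuallyEq_zero isPreconnected_univ (mem_univ _) hev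
  have := hzero (mem_univ (y 0, y 1))
  rw [comp_apply, hιsurj y hy] at this
  exact this

/-- **STUB HP4 `stub_slabNullRigidity` (VERBATIM, line `hot_loops` v2 of crux `PoloidalWindowRigidity`).** -/
theorem stub_slabNullRigidity :
    ∀ (C : ℝ) (v : ℝ → EuclideanSpace ℝ (Fin 3) → EuclideanSpace ℝ (Fin 3)),
      Literature.Analysis.FluidPDE.HasTypeITimeDecay C v →
      ContinuousOn (Function.uncurry v) (Set.Iio (0 : ℝ) ×ˢ Set.univ) →
      (∀ s t : ℝ, s < t → t < 0 → ∀ x, v t x =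
        Literature.Analysis.UnboundedOperators.heatExtension (v s) (t - s) x -
          Literature.Analysis.FluidPDE.oseenDuhamel 1 s v v t x) →
      (∀ t < 0, Literature.Analysis.FluidPDE.VectorCalculus.IsDivFree (v t)) →
      (∀ s < 0, ∀ y, ⟪Literature.Analysis.FluidPDE.curl (v s) y, EuclideanSpace.single 2 1⟫_ℝ = 0) →
      v (-1) 0 2 ≠ 0 → (∀ t < 0, ∀ x, Real.sqrt (-t) * |v t x 2| ≤ |v (-1) 0 2|) →
      (∃ δ : ℝ, 0 < δ ∧ ∀ s z₀ : ℝ, |s + 1| < δ → |z₀| < δ →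
          (∃ (y₀ : EuclideanSpace ℝ (Fin 3)) (r : ℝ), y₀ 2 = z₀ ∧ 0 < r ∧
          ∀ y : EuclideanSpace ℝ (Fin 3), y 2 = z₀ → dist y y₀ < r → Literature.Analysis.FluidPDE.curl (v s) y = 0)) →
      False := by
  intro C v hrate hcont hmild hdiv _hpol hN hsup hnull
  obtain ⟨δ, hδ, hnull⟩ := hnull
  have hA : IsTypeIAncientMild C v := isTypeIAncientMild_of_class hrate hcont hmild hdiv
  -- a time window below `-1/2` on which every slice is irrotational, hence constant
  set δ' : ℝ := min δ (1 / 2) with hδ'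
  have hδ'0 : 0 < δ' := lt_min hδ (by norm_num)
  have hδ'δ : δ' ≤ δ := min_le_left _ _
  have hδ'h : δ' ≤ 1 / 2 := min_le_right _ _
  obtain ⟨B, hB⟩ := bdd_of_hasTypeITimeDecay hrate (1 / 4) (by norm_num)
  have hconst : ∀ s : ℝ, |s + 1| < δ' → ∀ x y : EuclideanSpace ℝ (Fin 3), v s x = v s y := by
    intro s hs x y
    have hs' := abs_lt.1 hs
    have hs0 : s < 0 := by linarith
    have han : AnalyticOnNhd ℝ (v s) univ := hA.analyticOnNhd_slice_univ hs0
    -- every plane `{y₂ = z₀}`, `|z₀| < δ`, is irrotational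
    have hplane : ∀ z₀ : ℝ, |z₀| < δ → ∀ w : EuclideanSpace ℝ (Fin 3), w 2 = z₀ → curl (v s) w = 0 := by
      intro z₀ hz₀ w hw
      obtain ⟨y₀, r, hy₀, hr, hdisc⟩ := hnull s z₀ (lt_of_lt_of_le hs hδ'δ) hz₀
      exact curl_eq_zero_on_plane_of_disc han hy₀ hr hdisc w hw
    -- hence the open slab `{|y₂| < δ}` and all of `ℝ³`
    have hslab : ∀ w ∈ {w : EuclideanSpace ℝ (Fin 3) | |w 2| < δ}, curl (v s) w = 0 :=
      fun w hw => hplane (w 2) hw w rfl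
    have hopen : IsOpen {w : EuclideanSpace ℝ (Fin 3) | |w 2| < δ} :=
      isOpen_lt (continuous_abs.comp (EuclideanSpace.proj (2 : Fin 3)).continuous) continuous_const
    have hcurl : ∀ w, curl (v s) w = 0 :=
      curl_eq_zero_of_eqOn_open han hopen ⟨0, by simpa using hδ⟩ hslab
    have hV2 : ContDiff ℝ 2 (v s) := contDiff_infty.1 (hA.contDiff_slice hs0) 2
    exact eq_of_curl_eq_zero_of_isDivFree_of_bounded hV2 hcurl (hdiv s hs0) (fun z => hB s (by linarith) z) x y
  -- the mild identity between `s₁ = -1 - δ'/2` and `-1`: `v(-1) ≡ v(s₁) 0`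
  set s₁ : ℝ := -1 - δ' / 2 with hs₁
  have hs₁w : |s₁ + 1| < δ' := by rw [hs₁, show -1 - δ' / 2 + 1 = -(δ' / 2) by ring, abs_neg, abs_of_pos (by positivity)]; linarith
  have hmid : ∀ τ ∈ Ioo s₁ (-1), ∀ y : EuclideanSpace ℝ (Fin 3), v τ y = v τ 0 := by
    intro τ hτ y
    refine hconst τ ?_ y 0
    rw [abs_lt]; constructor <;> linarith [hτ.1, hτ.2]
  have hD : ∀ x, oseenDuhamel 1 s₁ v v (-1) x = 0 := fun x =>
    oseenDuhamel_eq_zero_of_const (b := fun τ => v τ 0) (c := fun τ => v τ 0) hmid hmid x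
  have hv1 : ∀ x : EuclideanSpace ℝ (Fin 3), v (-1) x = v s₁ 0 := by
    intro x
    have h := hmild s₁ (-1) (by rw [hs₁]; linarith) (by norm_num) x
    have hfun : v s₁ = fun _ => v s₁ 0 := funext fun y => hconst s₁ hs₁w y 0
    rw [hD x, sub_zero, hfun, heatExtension_const _ (by rw [hs₁]; linarith)] at h
    exact h
  -- the hot-spot bound at `s₁ < -1` is violated
  have hN1 : v s₁ 0 2 = v (-1) 0 2 := by rw [hv1 0]
  have h := hsup s₁ (by rw [hs₁]; linarith) 0
  rw [hN1] at h
  have hNpos : 0 < |v (-1) 0 2| := abs_pos.2 hN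
  have hsqrt : 1 < Real.sqrt (-s₁) := by
    rw [show (1 : ℝ) = Real.sqrt 1 by simp]
    exact Real.sqrt_lt_sqrt (by norm_num) (by rw [hs₁]; linarith)
  nlinarith

end Summit.NavierStokesRegularity.NavierStokesRegularity.Theorems.PoloidalWindowDoorPoloidalWindowRigidityHotLoopsSlabNullRigidity

end
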